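import Literature.Computability.MetaComplexity.RefutationCNF
import Literature.Computability.MetaComplexity.LevelledRefutationCNF
import Literature.Computability.MetaComplexity.LevelledRefutationCNFProofs
import Literature.Computability.MetaComplexity.ResolutionWidth
import Literature.Computability.MetaComplexity.ResolutionRestrictionMap
import HarnessLib

/-!
# Garlík's transfer: refutations of `REF(F,s̃)` restrict to refutations of `REF^F_{n+1,t}`

This file proves Theorem 26 of [Garlík 2019, arXiv version, §7 "Formula REF of Atserias and
Müller"] — the Resolution length lower bound for Pudlák's / Atserias–Müller's refutation
statement `REF(F,s̃)` (`refCNF`, file `RefutationCNF.lean`), the tree's named fact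
`refCNF_lowerBound_Garlik` — FROM Garlík's main theorem [Garlík 2019, Thm 1] for his levelled
formula `REF^F_{s,t}` (`levelledRefCNF`, the named fact `levelledRefCNF_lowerBound` of
`LevelledRefutationCNF.lean`):

* `refCNF_lowerBound_Garlik_of_levelled : levelledRefCNF_lowerBound → refCNF_lowerBound_Garlik`.

The proof is the one printed in [Garlík 2019, §7]: write `s̃ = q + t(n+1)` with
`t = ⌊s̃/(n+1)⌋`; a partial assignment `rho` of the variables of `REF(F,s̃)` makes the `q` prefix
lines weakenings of `C_1` that are never used as premises, arranges the remaining `t(n+1)` lines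
into `n+1` levels of `t` lines, fixes `V(u) = L(u) = R(u) = 0` on the first level and `I(u) = 0`
above it, and kills every premise pointer not going to the level just below; the surviving
variables are renamed (`ren`) into the variables of `REF^F_{n+1,t}`. We check, clause family by
clause family ((A1)–(A21) of [Atserias–Müller 2020, Appendix] against (B1)–(B15) of
[Garlík 2019, §3]), that every clause of `REF(F,s̃)` is either satisfied by `rho` or becomes —
as a set-clause — a clause of `REF^F_{n+1,t}` (`GarlikTransfer.good_of_mem_ref`; some clauses
of `REF^F_{n+1,t}`, e.g. those of (B5)/(B6) with `ℓ' = ℓ`, which Garlík removes "because they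
follow from (B2)–(B4) anyway", are not images of clauses of `REF(F,s̃)` — extra clauses of the
target are harmless for refuting it). The general length-preserving restriction lemma
`IsResRefutation.exists_map_restrict` (`ResolutionRestrictionMap.lean`) then turns every
Resolution refutation of `refCNF F s̃` into one of `levelledRefCNF F (n+1) t` of the same length
(`exists_levelled_refutation_of_refCNF`; two more applications of the same lemma move between the
`ℕ`-codings and the structured variable types), and Theorem 1 applies with `s = n + 1 ≤ t`
(from `t ≥ r^{3+ε} ≥ n³`), the same `δ` and `t₀`.

## Main statements

* `GarlikTransfer.rho`, `GarlikTransfer.ren` — the partial assignment and the renaming;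
* `GarlikTransfer.good_of_mem_ref` — the clause-by-clause verification;
* `exists_levelled_refutation_of_refCNF` — refutations of `REF(F,s̃)` give refutations of
  `REF^F_{n+1,⌊s̃/(n+1)⌋}` of the same length [Garlík 2019, §7, "the substitution just described
  takes any refutation of REF(F,s̃) to a refutation of REF^F_{n+1,t} without any increase in
  size"];
* `refCNF_lowerBound_Garlik_of_levelled` — [Garlík 2019, Thm 26] from [Garlík 2019, Thm 1].
* `refCNF_lowerBound_Garlik_holds` — the discharge of the named fact `refCNF_lowerBound_Garlik`
  [Garlík 2019, Thm 26], from the tree's discharge `levelledRefCNF_lowerBound_holds` of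
  [Garlík 2019, Thm 1] (`LevelledRefutationCNFProofs.lean`).

Not here: Theorem 1 itself (the random-restriction / adversary argument of [Garlík 2019,
§§4–6]), proved in `LevelledRefutationCNFProofs.lean` (`levelledRefCNF_lowerBound_holds`); the
discharge `refCNF_lowerBound_Garlik_holds` is exactly `refCNF_lowerBound_Garlik_of_levelled`
applied to it.

## References

* M. Garlík, *Resolution lower bounds for refutation statements*, MFCS 2019, LIPIcs 138,
  37:1–37:13; full version arXiv:1905.12372, §7, Theorem 26 (and Thm 1, §3).
* A. Atserias, M. Müller, *Automating Resolution is NP-hard*, J. ACM 67 (2020), Appendix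
  (clauses (A1)–(A21) of REF).
-/

namespace Literature.Computability.MetaComplexity

open Literature.Computability.Complexity

namespace GarlikTransfer

/-! ### Levels and positions of the lines of `REF(F,s̃)` -/

/-- The level of the line `u ≥ q` of `REF(F,s̃)` in Garlík's arrangement of the last `t(n+1)`
lines into `n+1` levels of `t` consecutive lines (after `q = s̃ - t(n+1)` prefix lines):
`⌊(u-q)/t⌋` (0-based). [cite: Garlik2019, §7 (proof of Thm 26: "arrange the remaining clauses
into n+1 levels of t clauses")] -/
def lvl (q t u : ℕ) : ℕ := (u - q) / t

/-- The position of the line `u ≥ q` inside its level: `(u-q) mod t` (0-based).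
[cite: Garlik2019, §7 (proof of Thm 26)] -/
def pos (q t u : ℕ) : ℕ := (u - q) % t

section Arith

variable {q t : ℕ}

/-- Decomposition of a level line into level and position. [folklore] -/
theorem eq_lvl_pos {u : ℕ} (hu : q ≤ u) : u = q + t * lvl q t u + pos q t u := by
  have := Nat.div_add_mod (u - q) t
  unfold lvl pos
  omega

/-- Positions are `< t`. [folklore] -/
theorem pos_lt (ht : 0 < t) (u : ℕ) : pos q t u < t := Nat.mod_lt _ ht

/-- Level and position of the line `q + t i + j`. [folklore] -/
theorem lvl_pos_mk (ht : 0 < t) (i : ℕ) {j : ℕ} (hj : j < t) :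
    lvl q t (q + t * i + j) = i ∧ pos q t (q + t * i + j) = j := by
  unfold lvl pos
  have h1 : q + t * i + j - q = j + t * i := by omega
  rw [h1, Nat.add_mul_div_left _ _ ht, Nat.add_mul_mod_self_left, Nat.div_eq_of_lt hj,
    Nat.mod_eq_of_lt hj]
  simp

/-- A level line is determined by its level and position. [folklore] -/
theorem eq_of_lvl_eq_pos_eq {u u' : ℕ} (hu : q ≤ u) (hu' : q ≤ u') (hl : lvl q t u = lvl q t u')
    (hp : pos q t u = pos q t u') : u = u' := by
  rw [eq_lvl_pos (t := t) hu, eq_lvl_pos (t := t) hu', hl, hp]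

/-- The lines `u < s̃ = q + t(n+1)` have level `≤ n`. [folklore] -/
theorem lvl_le {u n : ℕ} (ht : 0 < t) (hu : u < q + t * (n + 1)) : lvl q t u ≤ n := by
  unfold lvl
  have hpos : 0 < t * (n + 1) := Nat.mul_pos ht (Nat.succ_pos n)
  have : (u - q) / t < n + 1 := (Nat.div_lt_iff_lt_mul ht).2 (by rw [Nat.mul_comm]; omega)
  omega

/-- Levels are monotone along the line order. [folklore] -/
theorem lvl_mono {u v : ℕ} (huv : u ≤ v) : lvl q t u ≤ lvl q t v :=
  Nat.div_le_div_right (by omega)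

/-- A line of level `i` and position `j` is below `q + t(i+1)`. [folklore] -/
theorem lt_of_lvl_eq {u i : ℕ} (ht : 0 < t) (hu : q ≤ u) (hi : lvl q t u = i) :
    u < q + t * (i + 1) := by
  have h := eq_lvl_pos (t := t) hu
  have hp := pos_lt (q := q) ht u
  rw [hi] at h
  rw [Nat.mul_succ]
  omega

end Arith

/-! ### Garlík's partial assignment and renaming -/

/-- **Garlík's partial assignment** of the variables of `REF(F,s̃)` [Garlík 2019, §7, proof of
Thm 26], for the arrangement with `q` prefix lines and levels of `t` lines (`X` the variable list
of `F`): the prefix lines `u < q` are fully assigned, describing a weakening of the clause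
`C_1 = F[0]` not used as a premise (`D[u,ℓ,b]` true iff `x_ℓ^b ∈ C_1`, `I(u) = 1`,
`V(u) = L(u) = R(u) = 0`); on the first level `V(u) = L(u) = R(u) = 0` and `I(u) ≠ 0` is left
open; on higher levels `I(u) = 0`, `V(u) ≠ 0` is left open, and `L[u,v]`, `R[u,v]` are left open
exactly for `v` on the level just below `u` and falsified otherwise; all `D`-variables of level
lines are left open. (`P`-variables do not occur in `REF`; they are sent to `false`.)
[cite: Garlik2019, §7 (proof of Thm 26, the substitution)] -/
def rho (X : List ℕ) (F : CNF ℕ) (q t : ℕ) : RefVar → Option Bool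
  | .D u ℓ b =>
    if u < q then some ((F.getD 0 []).any fun l => X.idxOf l.1 == ℓ && l.2 == b) else none
  | .V u none => some (decide (u < q ∨ lvl q t u = 0))
  | .V u (some _) => if u < q ∨ lvl q t u = 0 then some false else none
  | .I u none => some (decide (q ≤ u ∧ lvl q t u ≠ 0))
  | .I u (some m) =>
    if u < q then some (decide (m = 0)) else if lvl q t u = 0 then none else some false
  | .L u none => some (decide (u < q ∨ lvl q t u = 0))
  | .L u (some v) =>
    if u < q ∨ lvl q t u = 0 then some false
    else if q ≤ v ∧ lvl q t v + 1 = lvl q t u then none else some false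
  | .R u none => some (decide (u < q ∨ lvl q t u = 0))
  | .R u (some v) =>
    if u < q ∨ lvl q t u = 0 then some false
    else if q ≤ v ∧ lvl q t v + 1 = lvl q t u then none else some false
  | .P _ => some false

/-- **Garlík's renaming** of the unassigned variables of `REF(F,s̃)` into variables of
`REF^F_{n+1,t}` [Garlík 2019, §7]: a level line `u` becomes the clause `C_{lvl u, pos u}`; the
Atserias–Müller left premise pointer `L` (premise containing the NEGATIVE pivot literal, clause
(A15)) becomes Garlík's `R`, and `R` becomes Garlík's `L` (clauses (B4), (B3)). Values on
assigned variables are irrelevant junk. [cite: Garlik2019, §7 (proof of Thm 26, "replace all the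
non-evaluated variables by the corresponding variables of REF^F_{n+1,t}")] -/
def ren (q t : ℕ) : RefVar → LRefVar
  | .D u ℓ b => .D (lvl q t u) (pos q t u) ℓ b
  | .V u (some ℓ) => .V (lvl q t u) (pos q t u) ℓ
  | .I u (some m) => .I (pos q t u) m
  | .L u (some v) => .R (lvl q t u) (pos q t u) (pos q t v)
  | .R u (some v) => .L (lvl q t u) (pos q t u) (pos q t v)
  | _ => .I 0 0

section RhoLemmas

variable {X : List ℕ} {F : CNF ℕ} {q t : ℕ}

/-! Values of `rho` on the three kinds of lines (prefix `u < q`, first level, higher levels). -/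

/-- `D`-variables of level lines are unassigned. [cite: Garlik2019, §7 (proof of Thm 26)] -/
theorem rho_D_of_le {u : ℕ} (hu : q ≤ u) (ℓ : ℕ) (b : Bool) :
    rho X F q t (.D u ℓ b) = none := by
  simp [rho, not_lt.2 hu]

/-- `D`-variables of prefix lines describe the clause `C_1 = F[0]`.
[cite: Garlik2019, §7 (proof of Thm 26)] -/
theorem rho_D_of_lt {u : ℕ} (hu : u < q) (ℓ : ℕ) (b : Bool) :
    rho X F q t (.D u ℓ b) = some ((F.getD 0 []).any fun l => X.idxOf l.1 == ℓ && l.2 == b) := by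
  simp [rho, hu]

/-- Prefix lines are not resolvents: `V(u) = 0`. [cite: Garlik2019, §7 (proof of Thm 26)] -/
theorem rho_V_none_of_lt {u : ℕ} (hu : u < q) : rho X F q t (.V u none) = some true := by
  simp [rho, hu]

/-- First-level lines are not resolvents: `V(u) = 0`. [cite: Garlik2019, §7 (proof of Thm 26)] -/
theorem rho_V_none_of_lvl_zero {u : ℕ} (h0 : lvl q t u = 0) :
    rho X F q t (.V u none) = some true := by
  simp [rho, h0]

/-- Higher-level lines are resolvents: `V(u) ≠ 0`. [cite: Garlik2019, §7 (proof of Thm 26)] -/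
theorem rho_V_none_of_upper {u : ℕ} (hu : q ≤ u) (h0 : lvl q t u ≠ 0) :
    rho X F q t (.V u none) = some false := by
  simp [rho, not_lt.2 hu, h0]

/-- Prefix lines have no pivot. [cite: Garlik2019, §7 (proof of Thm 26)] -/
theorem rho_V_some_of_lt {u : ℕ} (hu : u < q) (ℓ : ℕ) :
    rho X F q t (.V u (some ℓ)) = some false := by
  simp [rho, hu]

/-- First-level lines have no pivot. [cite: Garlik2019, §7 (proof of Thm 26)] -/
theorem rho_V_some_of_lvl_zero {u : ℕ} (h0 : lvl q t u = 0) (ℓ : ℕ) :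
    rho X F q t (.V u (some ℓ)) = some false := by
  simp [rho, h0]

/-- The pivot of a higher-level line is left open. [cite: Garlik2019, §7 (proof of Thm 26)] -/
theorem rho_V_some_of_upper {u : ℕ} (hu : q ≤ u) (h0 : lvl q t u ≠ 0) (ℓ : ℕ) :
    rho X F q t (.V u (some ℓ)) = none := by
  simp [rho, not_lt.2 hu, h0]

/-- Prefix lines are axioms: `I(u) ≠ 0`. [cite: Garlik2019, §7 (proof of Thm 26)] -/
theorem rho_I_none_of_lt {u : ℕ} (hu : u < q) : rho X F q t (.I u none) = some false := by
  simp [rho, hu]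

/-- First-level lines are axioms: `I(u) ≠ 0`. [cite: Garlik2019, §7 (proof of Thm 26)] -/
theorem rho_I_none_of_lvl_zero {u : ℕ} (h0 : lvl q t u = 0) :
    rho X F q t (.I u none) = some false := by
  simp [rho, h0]

/-- Higher-level lines are not axioms: `I(u) = 0`. [cite: Garlik2019, §7 (proof of Thm 26)] -/
theorem rho_I_none_of_upper {u : ℕ} (hu : q ≤ u) (h0 : lvl q t u ≠ 0) :
    rho X F q t (.I u none) = some true := by
  simp [rho, hu, h0]

/-- Prefix lines are weakenings of `C_1`: `I(u) = 1`. [cite: Garlik2019, §7 (proof of Thm 26)] -/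
theorem rho_I_some_of_lt {u : ℕ} (hu : u < q) (m : ℕ) :
    rho X F q t (.I u (some m)) = some (decide (m = 0)) := by
  simp [rho, hu]

/-- The axiom index of a first-level line is left open. [cite: Garlik2019, §7 (proof of Thm 26)] -/
theorem rho_I_some_of_lvl_zero {u : ℕ} (hu : q ≤ u) (h0 : lvl q t u = 0) (m : ℕ) :
    rho X F q t (.I u (some m)) = none := by
  simp [rho, not_lt.2 hu, h0]

/-- Higher-level lines have no axiom index. [cite: Garlik2019, §7 (proof of Thm 26)] -/
theorem rho_I_some_of_upper {u : ℕ} (hu : q ≤ u) (h0 : lvl q t u ≠ 0) (m : ℕ) :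
    rho X F q t (.I u (some m)) = some false := by
  simp [rho, not_lt.2 hu, h0]

/-- Prefix lines have no left premise: `L(u) = 0`. [cite: Garlik2019, §7 (proof of Thm 26)] -/
theorem rho_L_none_of_lt {u : ℕ} (hu : u < q) : rho X F q t (.L u none) = some true := by
  simp [rho, hu]

/-- First-level lines have no left premise: `L(u) = 0`. [cite: Garlik2019, §7 (proof of Thm 26)] -/
theorem rho_L_none_of_lvl_zero {u : ℕ} (h0 : lvl q t u = 0) :
    rho X F q t (.L u none) = some true := by
  simp [rho, h0]

/-- Higher-level lines have a left premise: `L(u) ≠ 0`. [cite: Garlik2019, §7 (proof of Thm 26)] -/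
theorem rho_L_none_of_upper {u : ℕ} (hu : q ≤ u) (h0 : lvl q t u ≠ 0) :
    rho X F q t (.L u none) = some false := by
  simp [rho, not_lt.2 hu, h0]

/-- Prefix lines have no right premise: `R(u) = 0`. [cite: Garlik2019, §7 (proof of Thm 26)] -/
theorem rho_R_none_of_lt {u : ℕ} (hu : u < q) : rho X F q t (.R u none) = some true := by
  simp [rho, hu]

/-- First-level lines have no right premise: `R(u) = 0`. [cite: Garlik2019, §7 (proof of Thm 26)] -/
theorem rho_R_none_of_lvl_zero {u : ℕ} (h0 : lvl q t u = 0) :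
    rho X F q t (.R u none) = some true := by
  simp [rho, h0]

/-- Higher-level lines have a right premise: `R(u) ≠ 0`. [cite: Garlik2019, §7 (proof of Thm 26)] -/
theorem rho_R_none_of_upper {u : ℕ} (hu : q ≤ u) (h0 : lvl q t u ≠ 0) :
    rho X F q t (.R u none) = some false := by
  simp [rho, not_lt.2 hu, h0]

/-- Prefix lines point to no line. [cite: Garlik2019, §7 (proof of Thm 26)] -/
theorem rho_L_some_of_lt {u : ℕ} (hu : u < q) (v : ℕ) :
    rho X F q t (.L u (some v)) = some false := by
  simp [rho, hu]

/-- First-level lines point to no line. [cite: Garlik2019, §7 (proof of Thm 26)] -/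
theorem rho_L_some_of_lvl_zero {u : ℕ} (h0 : lvl q t u = 0) (v : ℕ) :
    rho X F q t (.L u (some v)) = some false := by
  simp [rho, h0]

/-- Left pointers from a higher level to the level just below are left open.
[cite: Garlik2019, §7 (proof of Thm 26)] -/
theorem rho_L_some_of_good {u v : ℕ} (hu : q ≤ u) (h0 : lvl q t u ≠ 0) (hv : q ≤ v)
    (hlv : lvl q t v + 1 = lvl q t u) : rho X F q t (.L u (some v)) = none := by
  simp [rho, not_lt.2 hu, h0, hv, hlv]

/-- Left pointers not going to the level just below are killed.
[cite: Garlik2019, §7 (proof of Thm 26)] -/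
theorem rho_L_some_of_bad {u v : ℕ} (hu : q ≤ u) (h0 : lvl q t u ≠ 0)
    (hv : ¬ (q ≤ v ∧ lvl q t v + 1 = lvl q t u)) : rho X F q t (.L u (some v)) = some false := by
  simp only [rho, not_lt.2 hu, h0, or_self, if_false]
  rw [if_neg hv]

/-- Prefix lines point to no line (right pointer). [cite: Garlik2019, §7 (proof of Thm 26)] -/
theorem rho_R_some_of_lt {u : ℕ} (hu : u < q) (v : ℕ) :
    rho X F q t (.R u (some v)) = some false := by
  simp [rho, hu]

/-- First-level lines point to no line (right pointer). [cite: Garlik2019, §7 (proof of Thm 26)] -/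
theorem rho_R_some_of_lvl_zero {u : ℕ} (h0 : lvl q t u = 0) (v : ℕ) :
    rho X F q t (.R u (some v)) = some false := by
  simp [rho, h0]

/-- Right pointers from a higher level to the level just below are left open.
[cite: Garlik2019, §7 (proof of Thm 26)] -/
theorem rho_R_some_of_good {u v : ℕ} (hu : q ≤ u) (h0 : lvl q t u ≠ 0) (hv : q ≤ v)
    (hlv : lvl q t v + 1 = lvl q t u) : rho X F q t (.R u (some v)) = none := by
  simp [rho, not_lt.2 hu, h0, hv, hlv]

/-- Right pointers not going to the level just below are killed.
[cite: Garlik2019, §7 (proof of Thm 26)] -/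
theorem rho_R_some_of_bad {u v : ℕ} (hu : q ≤ u) (h0 : lvl q t u ≠ 0)
    (hv : ¬ (q ≤ v ∧ lvl q t v + 1 = lvl q t u)) : rho X F q t (.R u (some v)) = some false := by
  simp only [rho, not_lt.2 hu, h0, or_self, if_false]
  rw [if_neg hv]

/-- The variables left unassigned by `rho`. [folklore] -/
theorem rho_eq_none_iff (x : RefVar) : rho X F q t x = none ↔
    (∃ u ℓ b, x = .D u ℓ b ∧ q ≤ u) ∨
    (∃ u ℓ, x = .V u (some ℓ) ∧ q ≤ u ∧ lvl q t u ≠ 0) ∨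
    (∃ u m, x = .I u (some m) ∧ q ≤ u ∧ lvl q t u = 0) ∨
    (∃ u v, x = .L u (some v) ∧ q ≤ u ∧ lvl q t u ≠ 0 ∧ q ≤ v ∧ lvl q t v + 1 = lvl q t u) ∨
    (∃ u v, x = .R u (some v) ∧ q ≤ u ∧ lvl q t u ≠ 0 ∧ q ≤ v ∧ lvl q t v + 1 = lvl q t u) := by
  cases x with
  | D u ℓ b =>
    by_cases hu : u < q
    · simp [rho, hu]
    · simp [rho, hu, not_lt.1 hu]
  | V u i =>
    cases i with
    | none => simp [rho]
    | some ℓ =>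
      by_cases hu : u < q
      · simp [rho, hu]
      · by_cases h0 : lvl q t u = 0
        · simp [rho, h0]
        · simp [rho, hu, h0, not_lt.1 hu]
  | I u j =>
    cases j with
    | none => simp [rho]
    | some m =>
      by_cases hu : u < q
      · simp [rho, hu]
      · by_cases h0 : lvl q t u = 0
        · simp [rho, hu, h0, not_lt.1 hu]
        · simp [rho, hu, h0]
  | L u w =>
    cases w with
    | none => simp [rho]
    | some v =>
      by_cases hu : u < q
      · simp [rho, hu]
      · by_cases h0 : lvl q t u = 0
        · simp [rho, h0]
        · by_cases hv : q ≤ v ∧ lvl q t v + 1 = lvl q t u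
          · simp [rho, hu, h0, hv, not_lt.1 hu]
          · simp only [rho, hu, h0, or_self, if_false]
            rw [if_neg hv]
            simp only [reduceCtorEq, false_iff]
            rintro (⟨_, _, _, h, -⟩ | ⟨_, _, h, -⟩ | ⟨_, _, h, -⟩ | ⟨u', v', h, -, -, hv1, hv2⟩ |
              ⟨_, _, h, -⟩)
            · exact h.elim
            · exact h.elim
            · exact h.elim
            · cases h
              exact hv ⟨hv1, hv2⟩
            · exact h.elim
  | R u w =>
    cases w with
    | none => simp [rho]
    | some v =>
      by_cases hu : u < q
      · simp [rho, hu]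
      · by_cases h0 : lvl q t u = 0
        · simp [rho, h0]
        · by_cases hv : q ≤ v ∧ lvl q t v + 1 = lvl q t u
          · simp [rho, hu, h0, hv, not_lt.1 hu]
          · simp only [rho, hu, h0, or_self, if_false]
            rw [if_neg hv]
            simp only [reduceCtorEq, false_iff]
            rintro (⟨_, _, _, h, -⟩ | ⟨_, _, h, -⟩ | ⟨_, _, h, -⟩ | ⟨_, _, h, -⟩ |
              ⟨u', v', h, -, -, hv1, hv2⟩)
            · exact h.elim
            · exact h.elim
            · exact h.elim
            · exact h.elim
            · cases h
              exact hv ⟨hv1, hv2⟩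
  | P u => simp [rho]

/-- **The renaming is injective on the unassigned variables** (for `t ≥ 1`). [folklore] -/
theorem ren_injOn (ht : 0 < t) (x y : RefVar) (hx : rho X F q t x = none)
    (hy : rho X F q t y = none) (h : ren q t x = ren q t y) : x = y := by
  have hpos := pos_lt (q := q) ht
  rw [rho_eq_none_iff] at hx hy
  rcases hx with ⟨u, ℓ, b, rfl, hu⟩ | ⟨u, ℓ, rfl, hu, h0⟩ | ⟨u, m, rfl, hu, h0⟩ |
      ⟨u, v, rfl, hu, h0, hv, hlv⟩ | ⟨u, v, rfl, hu, h0, hv, hlv⟩ <;>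
    rcases hy with ⟨u', ℓ', b', rfl, hu'⟩ | ⟨u', ℓ', rfl, hu', h0'⟩ | ⟨u', m', rfl, hu', h0'⟩ |
      ⟨u', v', rfl, hu', h0', hv', hlv'⟩ | ⟨u', v', rfl, hu', h0', hv', hlv'⟩ <;>
    simp only [ren, LRefVar.D.injEq, LRefVar.V.injEq, LRefVar.I.injEq, LRefVar.L.injEq,
      LRefVar.R.injEq, reduceCtorEq] at h
  · obtain ⟨hl, hp, rfl, rfl⟩ := h
    rw [eq_of_lvl_eq_pos_eq hu hu' hl hp]
  · obtain ⟨hl, hp, rfl⟩ := h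
    rw [eq_of_lvl_eq_pos_eq hu hu' hl hp]
  · obtain ⟨hp, rfl⟩ := h
    rw [eq_of_lvl_eq_pos_eq (t := t) hu hu' (by rw [h0, h0']) hp]
  · obtain ⟨hl, hp, hpv⟩ := h
    have huu : u = u' := eq_of_lvl_eq_pos_eq hu hu' hl hp
    subst huu
    have hvv : v = v' := eq_of_lvl_eq_pos_eq (t := t) hv hv' (by omega) hpv
    rw [hvv]
  · obtain ⟨hl, hp, hpv⟩ := h
    have huu : u = u' := eq_of_lvl_eq_pos_eq hu hu' hl hp
    subst huu
    have hvv : v = v' := eq_of_lvl_eq_pos_eq (t := t) hv hv' (by omega) hpv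
    rw [hvv]

end RhoLemmas

/-! ### The transfer condition, clause family by clause family -/

/-- The transfer condition of `IsResRefutation.exists_map_restrict` for one list-clause `C` of
`REF(F,s̃)` (target: Garlík's `REF^F_{n+1,t}` over `LRefVar`): `C` is satisfied by `rho`, or its
restriction renamed along `ren` is a set-clause of `REF^F_{n+1,t}`. [cite: Garlik2019, §7 (proof
of Thm 26: "after removing the satisfied clauses, the formula becomes REF^F_{n+1,t} up to a
renaming of variables")] -/
def Good (X : List ℕ) (F : CNF ℕ) (q t : ℕ) (C : Clause RefVar) : Prop :=
  SatisfiedBy (rho X F q t) C.toFinset ∨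
    (restrictClause (rho X F q t) C.toFinset).image
        (fun l => ((ren q t l.1, l.2) : Literal LRefVar)) ∈
      (LevelledRefCNF.lref X F (X.length + 1) t).clauseFinsets

section Families

variable {X : List ℕ} {F : CNF ℕ} {q t : ℕ}

/-- A clause containing a literal made true by `rho` is good. [folklore] -/
theorem good_of_sat {C : Clause RefVar} (l : Literal RefVar) (hl : l ∈ C)
    (h : rho X F q t l.1 = some l.2) : Good X F q t C :=
  Or.inl ⟨l, List.mem_toFinset.2 hl, h⟩

/-- A clause all of whose literals are unassigned and whose renaming is, as a set-clause, a clause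
of `REF^F_{n+1,t}` is good. [folklore] -/
theorem good_of_map {C : Clause RefVar} (B : Clause LRefVar)
    (hB : B ∈ LevelledRefCNF.lref X F (X.length + 1) t) (hnone : ∀ l ∈ C, rho X F q t l.1 = none)
    (heq : B.toFinset = (C.map fun l => ((ren q t l.1, l.2) : Literal LRefVar)).toFinset) :
    Good X F q t C := by
  right
  have : (restrictClause (rho X F q t) C.toFinset).image
      (fun l => ((ren q t l.1, l.2) : Literal LRefVar)) = B.toFinset := by
    rw [heq]
    ext l'
    simp only [Finset.mem_image, mem_restrictClause, List.mem_toFinset, List.mem_map]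
    constructor
    · rintro ⟨l, ⟨hl, -⟩, rfl⟩
      exact ⟨l, hl, rfl⟩
    · rintro ⟨l, hl, rfl⟩
      exact ⟨l, ⟨hl, hnone l hl⟩, rfl⟩
  rw [this]
  exact List.mem_map.2 ⟨B, hB, rfl⟩

/-- A clause whose restricted renaming is computed to be, as a set-clause, a clause of
`REF^F_{n+1,t}` is good. [folklore] -/
theorem good_of_image {C : Clause RefVar} (B : Clause LRefVar)
    (hB : B ∈ LevelledRefCNF.lref X F (X.length + 1) t)
    (heq : (restrictClause (rho X F q t) C.toFinset).image
      (fun l => ((ren q t l.1, l.2) : Literal LRefVar)) = B.toFinset) :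
    Good X F q t C :=
  Or.inr (heq ▸ List.mem_map.2 ⟨B, hB, rfl⟩)

/-- Trichotomy of lines: prefix, first level, higher level. [folklore] -/
theorem line_cases (q t u : ℕ) :
    u < q ∨ (q ≤ u ∧ lvl q t u = 0) ∨ (q ≤ u ∧ lvl q t u ≠ 0) := by
  by_cases h : u < q
  · exact Or.inl h
  · by_cases h0 : lvl q t u = 0
    · exact Or.inr (Or.inl ⟨not_lt.1 h, h0⟩)
    · exact Or.inr (Or.inr ⟨not_lt.1 h, h0⟩)

/-- `pfx false u = []`: the clauses of `REF` carry no guard. [folklore] -/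
@[simp] theorem pfx_false (u : ℕ) : RefCNF.pfx false u = [] := by
  simp [RefCNF.pfx]

/-- Membership in `lowerLevels`. [folklore] -/
theorem mem_lowerLevels {s p : ℕ} : p ∈ LevelledRefCNF.lowerLevels s ↔ p + 1 < s := by
  simp only [LevelledRefCNF.lowerLevels, List.mem_filter, List.mem_range, decide_eq_true_eq]
  omega

/-- The fifteen families are parts of `lref`. [folklore] -/
theorem mem_lref {X : List ℕ} {F : CNF ℕ} {s t : ℕ} {B : Clause LRefVar}
    (h : B ∈ LevelledRefCNF.B1 X F t ∨ B ∈ LevelledRefCNF.B2 s t X.length ∨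
      B ∈ LevelledRefCNF.B3 s t X.length ∨ B ∈ LevelledRefCNF.B4 s t X.length ∨
      B ∈ LevelledRefCNF.B5 s t X.length ∨ B ∈ LevelledRefCNF.B6 s t X.length ∨
      B ∈ LevelledRefCNF.B7 s t X.length ∨ B ∈ LevelledRefCNF.B8 s t X.length ∨
      B ∈ LevelledRefCNF.B9 t F.length ∨ B ∈ LevelledRefCNF.B10 s t ∨
      B ∈ LevelledRefCNF.B11 s t ∨ B ∈ LevelledRefCNF.B12 s t X.length ∨
      B ∈ LevelledRefCNF.B13 t F.length ∨ B ∈ LevelledRefCNF.B14 s t ∨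
      B ∈ LevelledRefCNF.B15 s t) :
    B ∈ LevelledRefCNF.lref X F s t := by
  simp only [LevelledRefCNF.lref, List.mem_append]
  tauto

/-- An upper level `lvl u ≠ 0` of a line `u < s̃` gives a lower level `lvl u - 1` of
`REF^F_{n+1,t}`. [folklore] -/
theorem pred_lvl_mem_lowerLevels {u : ℕ} (ht : 0 < t) {n : ℕ} (hu : u < q + t * (n + 1))
    (h0 : lvl q t u ≠ 0) : lvl q t u - 1 ∈ LevelledRefCNF.lowerLevels (n + 1) := by
  rw [mem_lowerLevels]
  have := lvl_le ht hu
  omega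

variable (X F)

/-- Family (A1): satisfied on the prefix and the first level (`V(u) = 0`), the clause (B8) of
`C_{lvl u, pos u}` on higher levels. [cite: Garlik2019, §7 (proof of Thm 26)] -/
theorem good_A1 (ht : 0 < t) {C : Clause RefVar}
    (hC : C ∈ RefCNF.A1 false (q + t * (X.length + 1)) X.length) :
    Good X F q t C := by
  simp only [RefCNF.A1, pfx_false, RefCNF.optRange, List.nil_append, List.map_cons, List.map_map,
    List.mem_map, List.mem_range] at hC
  obtain ⟨u, hu, rfl⟩ := hC
  rcases line_cases q t u with hpre | ⟨-, h0⟩ | ⟨hq, h0⟩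
  · exact good_of_sat (.V u none, true) (by simp) (rho_V_none_of_lt hpre)
  · exact good_of_sat (.V u none, true) (by simp) (rho_V_none_of_lvl_zero h0)
  · refine good_of_image
      ((List.range X.length).map fun ℓ => (LRefVar.V (lvl q t u) (pos q t u) ℓ, true))
      (mem_lref (by
        refine Or.inr (Or.inr (Or.inr (Or.inr (Or.inr (Or.inr (Or.inr (Or.inl ?_)))))))
        simp only [LevelledRefCNF.B8, List.mem_flatMap, List.mem_map, List.mem_range]
        refine ⟨lvl q t u - 1, pred_lvl_mem_lowerLevels ht hu h0, pos q t u, pos_lt ht u, ?_⟩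
        rw [Nat.sub_add_cancel (Nat.pos_of_ne_zero h0)])) ?_
    ext l'
    simp only [Finset.mem_image, mem_restrictClause, List.mem_toFinset, List.mem_cons,
      List.mem_map, List.mem_range, Function.comp_apply]
    constructor
    · rintro ⟨l, ⟨hl | ⟨ℓ, hℓ, rfl⟩, hρ⟩, rfl⟩
      · subst hl
        rw [rho_V_none_of_upper hq h0] at hρ
        exact absurd hρ (by simp)
      · exact ⟨ℓ, hℓ, rfl⟩
    · rintro ⟨ℓ, hℓ, rfl⟩
      exact ⟨(.V u (some ℓ), true), ⟨Or.inr ⟨ℓ, hℓ, rfl⟩, rho_V_some_of_upper hq h0 ℓ⟩, rfl⟩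

/-- Family (A2): satisfied on the prefix (`I(u) = 1`) and on higher levels (`I(u) = 0`), the
clause (B9) of position `pos u` on the first level. [cite: Garlik2019, §7 (proof of Thm 26)] -/
theorem good_A2 (ht : 0 < t) (hF : 0 < F.length) {C : Clause RefVar}
    (hC : C ∈ RefCNF.A2 false (q + t * (X.length + 1)) F.length) : Good X F q t C := by
  simp only [RefCNF.A2, pfx_false, RefCNF.optRange, List.nil_append, List.map_cons, List.map_map,
    List.mem_map, List.mem_range] at hC
  obtain ⟨u, -, rfl⟩ := hC
  rcases line_cases q t u with hpre | ⟨hq, h0⟩ | ⟨hq, h0⟩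
  · refine good_of_sat (.I u (some 0), true) ?_ (by rw [rho_I_some_of_lt hpre]; simp)
    exact List.mem_cons_of_mem _ (List.mem_map.2 ⟨0, List.mem_range.2 hF, rfl⟩)
  · refine good_of_image ((List.range F.length).map fun m => (LRefVar.I (pos q t u) m, true))
      (mem_lref (by
        refine Or.inr (Or.inr (Or.inr (Or.inr (Or.inr (Or.inr (Or.inr (Or.inr (Or.inl ?_))))))))
        simp only [LevelledRefCNF.B9, List.mem_map, List.mem_range]
        exact ⟨pos q t u, pos_lt ht u, rfl⟩)) ?_
    ext l'
    simp only [Finset.mem_image, mem_restrictClause, List.mem_toFinset, List.mem_cons,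
      List.mem_map, List.mem_range, Function.comp_apply]
    constructor
    · rintro ⟨l, ⟨hl | ⟨m, hm, rfl⟩, hρ⟩, rfl⟩
      · subst hl
        rw [rho_I_none_of_lvl_zero h0] at hρ
        exact absurd hρ (by simp)
      · exact ⟨m, hm, rfl⟩
    · rintro ⟨m, hm, rfl⟩
      exact ⟨(.I u (some m), true), ⟨Or.inr ⟨m, hm, rfl⟩, rho_I_some_of_lvl_zero hq h0 m⟩, rfl⟩
  · exact good_of_sat (.I u none, true) (by simp) (rho_I_none_of_upper hq h0)

/-- The line of level `lvl u - 1` and position `j'` (used to realise every premise pointer of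
(B10)/(B11) as an unassigned `L`/`R` variable). [folklore] -/
theorem exists_line_below (ht : 0 < t) {u n : ℕ} (h0 : lvl q t u ≠ 0)
    (hu : u < q + t * (n + 1)) {j' : ℕ} (hj' : j' < t) :
    ∃ v, v < q + t * (n + 1) ∧ q ≤ v ∧ lvl q t v + 1 = lvl q t u ∧ pos q t v = j' := by
  obtain ⟨hl, hp⟩ := lvl_pos_mk (q := q) ht (lvl q t u - 1) hj'
  refine ⟨q + t * (lvl q t u - 1) + j', ?_, by omega, by rw [hl]; omega, hp⟩
  have h1 := lt_of_lvl_eq ht (by omega) hl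
  have h2 : lvl q t u - 1 + 1 ≤ n + 1 := by have := lvl_le ht hu; omega
  exact lt_of_lt_of_le h1 (by have := Nat.mul_le_mul_left t h2; omega)

/-- Family (A3): satisfied on the prefix and the first level (`L(u) = 0`); on higher levels the
pointers to the level below stay open and give the clause (B11) (`R`-premise exists).
[cite: Garlik2019, §7 (proof of Thm 26)] -/
theorem good_A3 (ht : 0 < t) {C : Clause RefVar}
    (hC : C ∈ RefCNF.A3 false (q + t * (X.length + 1))) : Good X F q t C := by
  simp only [RefCNF.A3, pfx_false, RefCNF.optRange, List.nil_append, List.map_cons, List.map_map,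
    List.mem_map, List.mem_range] at hC
  obtain ⟨u, hu, rfl⟩ := hC
  rcases line_cases q t u with hpre | ⟨-, h0⟩ | ⟨hq, h0⟩
  · exact good_of_sat (.L u none, true) (by simp) (rho_L_none_of_lt hpre)
  · exact good_of_sat (.L u none, true) (by simp) (rho_L_none_of_lvl_zero h0)
  · refine good_of_image ((List.range t).map fun j' => (LRefVar.R (lvl q t u) (pos q t u) j', true))
      (mem_lref (by
        refine Or.inr (Or.inr (Or.inr (Or.inr (Or.inr (Or.inr (Or.inr (Or.inr (Or.inr (Or.inr
          (Or.inl ?_))))))))))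
        simp only [LevelledRefCNF.B11, List.mem_flatMap, List.mem_map, List.mem_range]
        refine ⟨lvl q t u - 1, pred_lvl_mem_lowerLevels ht hu h0, pos q t u, pos_lt ht u, ?_⟩
        rw [Nat.sub_add_cancel (Nat.pos_of_ne_zero h0)])) ?_
    ext l'
    simp only [Finset.mem_image, mem_restrictClause, List.mem_toFinset, List.mem_cons,
      List.mem_map, List.mem_range, Function.comp_apply]
    constructor
    · rintro ⟨l, ⟨hl | ⟨v, hv, rfl⟩, hρ⟩, rfl⟩
      · subst hl
        rw [rho_L_none_of_upper hq h0] at hρ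
        exact absurd hρ (by simp)
      · by_cases hgood : q ≤ v ∧ lvl q t v + 1 = lvl q t u
        · exact ⟨pos q t v, pos_lt ht v, rfl⟩
        · rw [rho_L_some_of_bad hq h0 hgood] at hρ
          exact absurd hρ (by simp)
    · rintro ⟨j', hj', rfl⟩
      obtain ⟨v, hvs, hqv, hlv, hpv⟩ := exists_line_below ht h0 hu hj'
      exact ⟨(.L u (some v), true), ⟨Or.inr ⟨v, hvs, rfl⟩, rho_L_some_of_good hq h0 hqv hlv⟩,
        by simp [ren, hpv]⟩

/-- Family (A4): as (A3), giving the clause (B10) (`L`-premise exists).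
[cite: Garlik2019, §7 (proof of Thm 26)] -/
theorem good_A4 (ht : 0 < t) {C : Clause RefVar}
    (hC : C ∈ RefCNF.A4 false (q + t * (X.length + 1))) : Good X F q t C := by
  simp only [RefCNF.A4, pfx_false, RefCNF.optRange, List.nil_append, List.map_cons, List.map_map,
    List.mem_map, List.mem_range] at hC
  obtain ⟨u, hu, rfl⟩ := hC
  rcases line_cases q t u with hpre | ⟨-, h0⟩ | ⟨hq, h0⟩
  · exact good_of_sat (.R u none, true) (by simp) (rho_R_none_of_lt hpre)
  · exact good_of_sat (.R u none, true) (by simp) (rho_R_none_of_lvl_zero h0)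
  · refine good_of_image ((List.range t).map fun j' => (LRefVar.L (lvl q t u) (pos q t u) j', true))
      (mem_lref (by
        refine Or.inr (Or.inr (Or.inr (Or.inr (Or.inr (Or.inr (Or.inr (Or.inr (Or.inr
          (Or.inl ?_)))))))))
        simp only [LevelledRefCNF.B10, List.mem_flatMap, List.mem_map, List.mem_range]
        refine ⟨lvl q t u - 1, pred_lvl_mem_lowerLevels ht hu h0, pos q t u, pos_lt ht u, ?_⟩
        rw [Nat.sub_add_cancel (Nat.pos_of_ne_zero h0)])) ?_
    ext l'
    simp only [Finset.mem_image, mem_restrictClause, List.mem_toFinset, List.mem_cons,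
      List.mem_map, List.mem_range, Function.comp_apply]
    constructor
    · rintro ⟨l, ⟨hl | ⟨v, hv, rfl⟩, hρ⟩, rfl⟩
      · subst hl
        rw [rho_R_none_of_upper hq h0] at hρ
        exact absurd hρ (by simp)
      · by_cases hgood : q ≤ v ∧ lvl q t v + 1 = lvl q t u
        · exact ⟨pos q t v, pos_lt ht v, rfl⟩
        · rw [rho_R_some_of_bad hq h0 hgood] at hρ
          exact absurd hρ (by simp)
    · rintro ⟨j', hj', rfl⟩
      obtain ⟨v, hvs, hqv, hlv, hpv⟩ := exists_line_below ht h0 hu hj'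
      exact ⟨(.R u (some v), true), ⟨Or.inr ⟨v, hvs, rfl⟩, rho_R_some_of_good hq h0 hqv hlv⟩,
        by simp [ren, hpv]⟩

/-- Membership in `optRange`. [folklore] -/
theorem mem_optRange {k : ℕ} {i : Option ℕ} :
    i ∈ RefCNF.optRange k ↔ i = none ∨ ∃ ℓ, ℓ < k ∧ i = some ℓ := by
  simp only [RefCNF.optRange, List.mem_cons, List.mem_map, List.mem_range]
  constructor
  · rintro (h | ⟨ℓ, hℓ, rfl⟩)
    · exact Or.inl h
    · exact Or.inr ⟨ℓ, hℓ, rfl⟩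
  · rintro (h | ⟨ℓ, hℓ, rfl⟩)
    · exact Or.inl h
    · exact Or.inr ⟨ℓ, hℓ, rfl⟩

/-- Family (A5): satisfied unless `u` is on a higher level and both indices are non-zero, in which
case it is the clause (B12) (cut variable unique). [cite: Garlik2019, §7 (proof of Thm 26)] -/
theorem good_A5 (ht : 0 < t) {C : Clause RefVar}
    (hC : C ∈ RefCNF.A5 false (q + t * (X.length + 1)) X.length) : Good X F q t C := by
  simp only [RefCNF.A5, pfx_false, List.nil_append, List.mem_flatMap, List.mem_map,
    List.mem_range, List.mem_filter] at hC
  obtain ⟨u, hu, i, hi, i', ⟨hi', hne⟩, rfl⟩ := hC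
  have hne' : i' ≠ i := by simpa using hne
  rcases line_cases q t u with hpre | ⟨-, h0⟩ | ⟨hq, h0⟩
  · rcases mem_optRange.1 hi with rfl | ⟨ℓ, -, rfl⟩
    · rcases mem_optRange.1 hi' with rfl | ⟨ℓ', -, rfl⟩
      · exact absurd rfl hne'
      · exact good_of_sat (.V u (some ℓ'), false) (by simp) (rho_V_some_of_lt hpre ℓ')
    · exact good_of_sat (.V u (some ℓ), false) (by simp) (rho_V_some_of_lt hpre ℓ)
  · rcases mem_optRange.1 hi with rfl | ⟨ℓ, -, rfl⟩
    · rcases mem_optRange.1 hi' with rfl | ⟨ℓ', -, rfl⟩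
      · exact absurd rfl hne'
      · exact good_of_sat (.V u (some ℓ'), false) (by simp) (rho_V_some_of_lvl_zero h0 ℓ')
    · exact good_of_sat (.V u (some ℓ), false) (by simp) (rho_V_some_of_lvl_zero h0 ℓ)
  · rcases mem_optRange.1 hi with rfl | ⟨ℓ, hℓ, rfl⟩
    · exact good_of_sat (.V u none, false) (by simp) (rho_V_none_of_upper hq h0)
    · rcases mem_optRange.1 hi' with rfl | ⟨ℓ', hℓ', rfl⟩
      · exact good_of_sat (.V u none, false) (by simp) (rho_V_none_of_upper hq h0)
      · have hℓℓ : ℓ' ≠ ℓ := fun h => hne' (by rw [h])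
        refine good_of_map
          [(LRefVar.V (lvl q t u) (pos q t u) ℓ, false),
            (LRefVar.V (lvl q t u) (pos q t u) ℓ', false)]
          (mem_lref ?_) ?_ (by simp [ren])
        · refine Or.inr (Or.inr (Or.inr (Or.inr (Or.inr (Or.inr (Or.inr (Or.inr (Or.inr (Or.inr
            (Or.inr (Or.inl ?_)))))))))))
          simp only [LevelledRefCNF.B12, List.mem_flatMap, List.mem_map, List.mem_range,
            List.mem_filter]
          refine ⟨lvl q t u - 1, pred_lvl_mem_lowerLevels ht hu h0, pos q t u, pos_lt ht u, ℓ, hℓ,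
            ℓ', ⟨hℓ', by simpa using hℓℓ⟩, ?_⟩
          rw [Nat.sub_add_cancel (Nat.pos_of_ne_zero h0)]
        · intro l hl
          simp only [List.mem_cons, List.not_mem_nil, or_false] at hl
          rcases hl with rfl | rfl
          · exact rho_V_some_of_upper hq h0 ℓ
          · exact rho_V_some_of_upper hq h0 ℓ'

/-- Family (A6): satisfied unless `u` is on the first level and both indices are non-zero, in
which case it is the clause (B13) (assigned clause of `F` unique).
[cite: Garlik2019, §7 (proof of Thm 26)] -/
theorem good_A6 (ht : 0 < t) {C : Clause RefVar}
    (hC : C ∈ RefCNF.A6 false (q + t * (X.length + 1)) F.length) : Good X F q t C := by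
  simp only [RefCNF.A6, pfx_false, List.nil_append, List.mem_flatMap, List.mem_map,
    List.mem_range, List.mem_filter] at hC
  obtain ⟨u, -, j, hj, j', ⟨hj', hne⟩, rfl⟩ := hC
  have hne' : j' ≠ j := by simpa using hne
  rcases line_cases q t u with hpre | ⟨hq, h0⟩ | ⟨hq, h0⟩
  · rcases mem_optRange.1 hj with rfl | ⟨m, -, rfl⟩
    · exact good_of_sat (.I u none, false) (by simp) (rho_I_none_of_lt hpre)
    · by_cases hm : m = 0
      · subst hm
        rcases mem_optRange.1 hj' with rfl | ⟨m', -, rfl⟩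
        · exact good_of_sat (.I u none, false) (by simp) (rho_I_none_of_lt hpre)
        · have hm' : m' ≠ 0 := fun h => hne' (by rw [h])
          exact good_of_sat (.I u (some m'), false) (by simp)
            (by rw [rho_I_some_of_lt hpre]; simp [hm'])
      · exact good_of_sat (.I u (some m), false) (by simp)
          (by rw [rho_I_some_of_lt hpre]; simp [hm])
  · rcases mem_optRange.1 hj with rfl | ⟨m, hm, rfl⟩
    · exact good_of_sat (.I u none, false) (by simp) (rho_I_none_of_lvl_zero h0)
    · rcases mem_optRange.1 hj' with rfl | ⟨m', hm', rfl⟩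
      · exact good_of_sat (.I u none, false) (by simp) (rho_I_none_of_lvl_zero h0)
      · have hmm : m' ≠ m := fun h => hne' (by rw [h])
        refine good_of_map [(LRefVar.I (pos q t u) m, false), (LRefVar.I (pos q t u) m', false)]
          (mem_lref ?_) ?_ (by simp [ren])
        · refine Or.inr (Or.inr (Or.inr (Or.inr (Or.inr (Or.inr (Or.inr (Or.inr (Or.inr (Or.inr
            (Or.inr (Or.inr (Or.inl ?_))))))))))))
          simp only [LevelledRefCNF.B13, List.mem_flatMap, List.mem_map, List.mem_range,
            List.mem_filter]
          exact ⟨pos q t u, pos_lt ht u, m, hm, m', ⟨hm', by simpa using hmm⟩, rfl⟩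
        · intro l hl
          simp only [List.mem_cons, List.not_mem_nil, or_false] at hl
          rcases hl with rfl | rfl
          · exact rho_I_some_of_lvl_zero hq h0 m
          · exact rho_I_some_of_lvl_zero hq h0 m'
  · rcases mem_optRange.1 hj with rfl | ⟨m, -, rfl⟩
    · rcases mem_optRange.1 hj' with rfl | ⟨m', -, rfl⟩
      · exact absurd rfl hne'
      · exact good_of_sat (.I u (some m'), false) (by simp) (rho_I_some_of_upper hq h0 m')
    · exact good_of_sat (.I u (some m), false) (by simp) (rho_I_some_of_upper hq h0 m)

/-- Two distinct lines on the same level have distinct positions. [folklore] -/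
theorem pos_ne_of_ne {v v' u : ℕ} (hv : q ≤ v ∧ lvl q t v + 1 = lvl q t u)
    (hv' : q ≤ v' ∧ lvl q t v' + 1 = lvl q t u) (hne : v' ≠ v) : pos q t v' ≠ pos q t v :=
  fun h => hne (eq_of_lvl_eq_pos_eq hv'.1 hv.1 (by omega) h)

/-- Family (A7): satisfied unless `u` is on a higher level and both pointers go to the level just
below, in which case it is the clause (B15) (`R`-premise unique).
[cite: Garlik2019, §7 (proof of Thm 26)] -/
theorem good_A7 (ht : 0 < t) {C : Clause RefVar}
    (hC : C ∈ RefCNF.A7 false (q + t * (X.length + 1))) : Good X F q t C := by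
  simp only [RefCNF.A7, pfx_false, List.nil_append, List.mem_flatMap, List.mem_map,
    List.mem_range, List.mem_filter] at hC
  obtain ⟨u, hu, w, hw, w', ⟨hw', hne⟩, rfl⟩ := hC
  have hne' : w' ≠ w := by simpa using hne
  rcases line_cases q t u with hpre | ⟨-, h0⟩ | ⟨hq, h0⟩
  · rcases mem_optRange.1 hw with rfl | ⟨v, -, rfl⟩
    · rcases mem_optRange.1 hw' with rfl | ⟨v', -, rfl⟩
      · exact absurd rfl hne'
      · exact good_of_sat (.L u (some v'), false) (by simp) (rho_L_some_of_lt hpre v')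
    · exact good_of_sat (.L u (some v), false) (by simp) (rho_L_some_of_lt hpre v)
  · rcases mem_optRange.1 hw with rfl | ⟨v, -, rfl⟩
    · rcases mem_optRange.1 hw' with rfl | ⟨v', -, rfl⟩
      · exact absurd rfl hne'
      · exact good_of_sat (.L u (some v'), false) (by simp) (rho_L_some_of_lvl_zero h0 v')
    · exact good_of_sat (.L u (some v), false) (by simp) (rho_L_some_of_lvl_zero h0 v)
  · rcases mem_optRange.1 hw with rfl | ⟨v, -, rfl⟩
    · exact good_of_sat (.L u none, false) (by simp) (rho_L_none_of_upper hq h0)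
    · rcases mem_optRange.1 hw' with rfl | ⟨v', -, rfl⟩
      · exact good_of_sat (.L u none, false) (by simp) (rho_L_none_of_upper hq h0)
      · by_cases hv : q ≤ v ∧ lvl q t v + 1 = lvl q t u
        · by_cases hv' : q ≤ v' ∧ lvl q t v' + 1 = lvl q t u
          · have hpp : pos q t v' ≠ pos q t v :=
              pos_ne_of_ne hv hv' (fun h => hne' (by rw [h]))
            refine good_of_map
              [(LRefVar.R (lvl q t u) (pos q t u) (pos q t v), false),
                (LRefVar.R (lvl q t u) (pos q t u) (pos q t v'), false)] (mem_lref ?_) ?_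
              (by simp [ren])
            · refine Or.inr (Or.inr (Or.inr (Or.inr (Or.inr (Or.inr (Or.inr (Or.inr (Or.inr (Or.inr
                (Or.inr (Or.inr (Or.inr (Or.inr ?_)))))))))))))
              simp only [LevelledRefCNF.B15, List.mem_flatMap, List.mem_map, List.mem_range,
                List.mem_filter]
              refine ⟨lvl q t u - 1, pred_lvl_mem_lowerLevels ht hu h0, pos q t u, pos_lt ht u,
                pos q t v, pos_lt ht v, pos q t v', ⟨pos_lt ht v', by simpa using hpp⟩, ?_⟩
              rw [Nat.sub_add_cancel (Nat.pos_of_ne_zero h0)]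
            · intro l hl
              simp only [List.mem_cons, List.not_mem_nil, or_false] at hl
              rcases hl with rfl | rfl
              · exact rho_L_some_of_good hq h0 hv.1 hv.2
              · exact rho_L_some_of_good hq h0 hv'.1 hv'.2
          · exact good_of_sat (.L u (some v'), false) (by simp) (rho_L_some_of_bad hq h0 hv')
        · exact good_of_sat (.L u (some v), false) (by simp) (rho_L_some_of_bad hq h0 hv)

/-- Family (A8): as (A7), giving the clause (B14) (`L`-premise unique).
[cite: Garlik2019, §7 (proof of Thm 26)] -/
theorem good_A8 (ht : 0 < t) {C : Clause RefVar}
    (hC : C ∈ RefCNF.A8 false (q + t * (X.length + 1))) : Good X F q t C := by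
  simp only [RefCNF.A8, pfx_false, List.nil_append, List.mem_flatMap, List.mem_map,
    List.mem_range, List.mem_filter] at hC
  obtain ⟨u, hu, w, hw, w', ⟨hw', hne⟩, rfl⟩ := hC
  have hne' : w' ≠ w := by simpa using hne
  rcases line_cases q t u with hpre | ⟨-, h0⟩ | ⟨hq, h0⟩
  · rcases mem_optRange.1 hw with rfl | ⟨v, -, rfl⟩
    · rcases mem_optRange.1 hw' with rfl | ⟨v', -, rfl⟩
      · exact absurd rfl hne'
      · exact good_of_sat (.R u (some v'), false) (by simp) (rho_R_some_of_lt hpre v')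
    · exact good_of_sat (.R u (some v), false) (by simp) (rho_R_some_of_lt hpre v)
  · rcases mem_optRange.1 hw with rfl | ⟨v, -, rfl⟩
    · rcases mem_optRange.1 hw' with rfl | ⟨v', -, rfl⟩
      · exact absurd rfl hne'
      · exact good_of_sat (.R u (some v'), false) (by simp) (rho_R_some_of_lvl_zero h0 v')
    · exact good_of_sat (.R u (some v), false) (by simp) (rho_R_some_of_lvl_zero h0 v)
  · rcases mem_optRange.1 hw with rfl | ⟨v, -, rfl⟩
    · exact good_of_sat (.R u none, false) (by simp) (rho_R_none_of_upper hq h0)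
    · rcases mem_optRange.1 hw' with rfl | ⟨v', -, rfl⟩
      · exact good_of_sat (.R u none, false) (by simp) (rho_R_none_of_upper hq h0)
      · by_cases hv : q ≤ v ∧ lvl q t v + 1 = lvl q t u
        · by_cases hv' : q ≤ v' ∧ lvl q t v' + 1 = lvl q t u
          · have hpp : pos q t v' ≠ pos q t v :=
              pos_ne_of_ne hv hv' (fun h => hne' (by rw [h]))
            refine good_of_map
              [(LRefVar.L (lvl q t u) (pos q t u) (pos q t v), false),
                (LRefVar.L (lvl q t u) (pos q t u) (pos q t v'), false)] (mem_lref ?_) ?_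
              (by simp [ren])
            · refine Or.inr (Or.inr (Or.inr (Or.inr (Or.inr (Or.inr (Or.inr (Or.inr (Or.inr (Or.inr
                (Or.inr (Or.inr (Or.inr (Or.inl ?_)))))))))))))
              simp only [LevelledRefCNF.B14, List.mem_flatMap, List.mem_map, List.mem_range,
                List.mem_filter]
              refine ⟨lvl q t u - 1, pred_lvl_mem_lowerLevels ht hu h0, pos q t u, pos_lt ht u,
                pos q t v, pos_lt ht v, pos q t v', ⟨pos_lt ht v', by simpa using hpp⟩, ?_⟩
              rw [Nat.sub_add_cancel (Nat.pos_of_ne_zero h0)]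
            · intro l hl
              simp only [List.mem_cons, List.not_mem_nil, or_false] at hl
              rcases hl with rfl | rfl
              · exact rho_R_some_of_good hq h0 hv.1 hv.2
              · exact rho_R_some_of_good hq h0 hv'.1 hv'.2
          · exact good_of_sat (.R u (some v'), false) (by simp) (rho_R_some_of_bad hq h0 hv')
        · exact good_of_sat (.R u (some v), false) (by simp) (rho_R_some_of_bad hq h0 hv)

/-- Family (A9): always satisfied (`I(u) ≠ 0` on the prefix and the first level, `V(u) ≠ 0`
above). [cite: Garlik2019, §7 (proof of Thm 26)] -/
theorem good_A9 {C : Clause RefVar} (hC : C ∈ RefCNF.A9 false (q + t * (X.length + 1))) :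
    Good X F q t C := by
  simp only [RefCNF.A9, pfx_false, List.nil_append, List.mem_map, List.mem_range] at hC
  obtain ⟨u, -, rfl⟩ := hC
  rcases line_cases q t u with hpre | ⟨-, h0⟩ | ⟨hq, h0⟩
  · exact good_of_sat (.I u none, false) (by simp) (rho_I_none_of_lt hpre)
  · exact good_of_sat (.I u none, false) (by simp) (rho_I_none_of_lvl_zero h0)
  · exact good_of_sat (.V u none, false) (by simp) (rho_V_none_of_upper hq h0)

/-- Family (A10): always satisfied (`V(u) = 0` on the prefix and the first level, `I(u) = 0`
above). [cite: Garlik2019, §7 (proof of Thm 26)] -/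
theorem good_A10 {C : Clause RefVar} (hC : C ∈ RefCNF.A10 false (q + t * (X.length + 1))) :
    Good X F q t C := by
  simp only [RefCNF.A10, pfx_false, List.nil_append, List.mem_map, List.mem_range] at hC
  obtain ⟨u, -, rfl⟩ := hC
  rcases line_cases q t u with hpre | ⟨-, h0⟩ | ⟨hq, h0⟩
  · exact good_of_sat (.V u none, true) (by simp) (rho_V_none_of_lt hpre)
  · exact good_of_sat (.V u none, true) (by simp) (rho_V_none_of_lvl_zero h0)
  · exact good_of_sat (.I u none, true) (by simp) (rho_I_none_of_upper hq h0)

/-- Family (A11): always satisfied. [cite: Garlik2019, §7 (proof of Thm 26)] -/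
theorem good_A11 {C : Clause RefVar} (hC : C ∈ RefCNF.A11 false (q + t * (X.length + 1))) :
    Good X F q t C := by
  simp only [RefCNF.A11, pfx_false, List.nil_append, List.mem_map, List.mem_range] at hC
  obtain ⟨u, -, rfl⟩ := hC
  rcases line_cases q t u with hpre | ⟨-, h0⟩ | ⟨hq, h0⟩
  · exact good_of_sat (.I u none, false) (by simp) (rho_I_none_of_lt hpre)
  · exact good_of_sat (.I u none, false) (by simp) (rho_I_none_of_lvl_zero h0)
  · exact good_of_sat (.L u none, false) (by simp) (rho_L_none_of_upper hq h0)

/-- Family (A12): always satisfied. [cite: Garlik2019, §7 (proof of Thm 26)] -/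
theorem good_A12 {C : Clause RefVar} (hC : C ∈ RefCNF.A12 false (q + t * (X.length + 1))) :
    Good X F q t C := by
  simp only [RefCNF.A12, pfx_false, List.nil_append, List.mem_map, List.mem_range] at hC
  obtain ⟨u, -, rfl⟩ := hC
  rcases line_cases q t u with hpre | ⟨-, h0⟩ | ⟨hq, h0⟩
  · exact good_of_sat (.I u none, false) (by simp) (rho_I_none_of_lt hpre)
  · exact good_of_sat (.I u none, false) (by simp) (rho_I_none_of_lvl_zero h0)
  · exact good_of_sat (.R u none, false) (by simp) (rho_R_none_of_upper hq h0)

/-- Family (A13): always satisfied (pointers never go up: `u ≤ v` forces `lvl u ≤ lvl v`).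
[cite: Garlik2019, §7 (proof of Thm 26)] -/
theorem good_A13 {C : Clause RefVar} (hC : C ∈ RefCNF.A13 false (q + t * (X.length + 1))) :
    Good X F q t C := by
  simp only [RefCNF.A13, pfx_false, List.nil_append, List.mem_flatMap, List.mem_map,
    List.mem_range, List.mem_filter, decide_eq_true_eq] at hC
  obtain ⟨u, -, v, ⟨-, huv⟩, rfl⟩ := hC
  rcases line_cases q t u with hpre | ⟨-, h0⟩ | ⟨hq, h0⟩
  · exact good_of_sat (.L u (some v), false) (by simp) (rho_L_some_of_lt hpre v)
  · exact good_of_sat (.L u (some v), false) (by simp) (rho_L_some_of_lvl_zero h0 v)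
  · refine good_of_sat (.L u (some v), false) (by simp) (rho_L_some_of_bad hq h0 ?_)
    rintro ⟨-, h⟩
    have := lvl_mono (q := q) (t := t) huv
    omega

/-- Family (A14): always satisfied. [cite: Garlik2019, §7 (proof of Thm 26)] -/
theorem good_A14 {C : Clause RefVar} (hC : C ∈ RefCNF.A14 false (q + t * (X.length + 1))) :
    Good X F q t C := by
  simp only [RefCNF.A14, pfx_false, List.nil_append, List.mem_flatMap, List.mem_map,
    List.mem_range, List.mem_filter, decide_eq_true_eq] at hC
  obtain ⟨u, -, v, ⟨-, huv⟩, rfl⟩ := hC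
  rcases line_cases q t u with hpre | ⟨-, h0⟩ | ⟨hq, h0⟩
  · exact good_of_sat (.R u (some v), false) (by simp) (rho_R_some_of_lt hpre v)
  · exact good_of_sat (.R u (some v), false) (by simp) (rho_R_some_of_lvl_zero h0 v)
  · refine good_of_sat (.R u (some v), false) (by simp) (rho_R_some_of_bad hq h0 ?_)
    rintro ⟨-, h⟩
    have := lvl_mono (q := q) (t := t) huv
    omega

/-- The lower level of a good pointer is a lower level of `REF^F_{n+1,t}`. [folklore] -/
theorem lvl_mem_lowerLevels_of_good (ht : 0 < t) {u v n : ℕ} (hu : u < q + t * (n + 1))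
    (hv : q ≤ v ∧ lvl q t v + 1 = lvl q t u) : lvl q t v ∈ LevelledRefCNF.lowerLevels (n + 1) := by
  rw [mem_lowerLevels]
  have := lvl_le ht hu
  omega

/-- Family (A15): satisfied unless `u` is on a higher level and `v` on the level just below, in
which case it is the clause (B4) (the `R`-premise contains the negative pivot literal).
[cite: Garlik2019, §7 (proof of Thm 26)] -/
theorem good_A15 (ht : 0 < t) {C : Clause RefVar}
    (hC : C ∈ RefCNF.A15 false (q + t * (X.length + 1)) X.length) : Good X F q t C := by
  simp only [RefCNF.A15, pfx_false, List.nil_append, List.mem_flatMap, List.mem_map,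
    List.mem_range] at hC
  obtain ⟨u, hu, v, -, ℓ, hℓ, rfl⟩ := hC
  rcases line_cases q t u with hpre | ⟨-, h0⟩ | ⟨hq, h0⟩
  · exact good_of_sat (.V u (some ℓ), false) (by simp) (rho_V_some_of_lt hpre ℓ)
  · exact good_of_sat (.V u (some ℓ), false) (by simp) (rho_V_some_of_lvl_zero h0 ℓ)
  · by_cases hv : q ≤ v ∧ lvl q t v + 1 = lvl q t u
    · refine good_of_map
        [(LRefVar.R (lvl q t u) (pos q t u) (pos q t v), false),
          (LRefVar.V (lvl q t u) (pos q t u) ℓ, false),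
          (LRefVar.D (lvl q t v) (pos q t v) ℓ false, true)]
        (mem_lref ?_) ?_ (by simp [ren])
      · refine Or.inr (Or.inr (Or.inr (Or.inl ?_)))
        simp only [LevelledRefCNF.B4, List.mem_flatMap, List.mem_map, List.mem_range]
        refine ⟨lvl q t v, lvl_mem_lowerLevels_of_good ht hu hv, pos q t u, pos_lt ht u, pos q t v,
          pos_lt ht v, ℓ, hℓ, ?_⟩
        rw [hv.2]
      · intro l hl
        simp only [List.mem_cons, List.not_mem_nil, or_false] at hl
        rcases hl with rfl | rfl | rfl
        · exact rho_L_some_of_good hq h0 hv.1 hv.2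
        · exact rho_V_some_of_upper hq h0 ℓ
        · exact rho_D_of_le hv.1 ℓ false
    · exact good_of_sat (.L u (some v), false) (by simp) (rho_L_some_of_bad hq h0 hv)

/-- Family (A16): as (A15), giving the clause (B3).
[cite: Garlik2019, §7 (proof of Thm 26)] -/
theorem good_A16 (ht : 0 < t) {C : Clause RefVar}
    (hC : C ∈ RefCNF.A16 false (q + t * (X.length + 1)) X.length) : Good X F q t C := by
  simp only [RefCNF.A16, pfx_false, List.nil_append, List.mem_flatMap, List.mem_map,
    List.mem_range] at hC
  obtain ⟨u, hu, v, -, ℓ, hℓ, rfl⟩ := hC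
  rcases line_cases q t u with hpre | ⟨-, h0⟩ | ⟨hq, h0⟩
  · exact good_of_sat (.V u (some ℓ), false) (by simp) (rho_V_some_of_lt hpre ℓ)
  · exact good_of_sat (.V u (some ℓ), false) (by simp) (rho_V_some_of_lvl_zero h0 ℓ)
  · by_cases hv : q ≤ v ∧ lvl q t v + 1 = lvl q t u
    · refine good_of_map
        [(LRefVar.L (lvl q t u) (pos q t u) (pos q t v), false),
          (LRefVar.V (lvl q t u) (pos q t u) ℓ, false),
          (LRefVar.D (lvl q t v) (pos q t v) ℓ true, true)]
        (mem_lref ?_) ?_ (by simp [ren])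
      · refine Or.inr (Or.inr (Or.inl ?_))
        simp only [LevelledRefCNF.B3, List.mem_flatMap, List.mem_map, List.mem_range]
        refine ⟨lvl q t v, lvl_mem_lowerLevels_of_good ht hu hv, pos q t u, pos_lt ht u, pos q t v,
          pos_lt ht v, ℓ, hℓ, ?_⟩
        rw [hv.2]
      · intro l hl
        simp only [List.mem_cons, List.not_mem_nil, or_false] at hl
        rcases hl with rfl | rfl | rfl
        · exact rho_R_some_of_good hq h0 hv.1 hv.2
        · exact rho_V_some_of_upper hq h0 ℓ
        · exact rho_D_of_le hv.1 ℓ true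
    · exact good_of_sat (.R u (some v), false) (by simp) (rho_R_some_of_bad hq h0 hv)

/-- Family (A17): satisfied unless `u` is on a higher level and `v` on the level just below, in
which case it is a clause of (B6) (side literals of the `R`-premise are kept).
[cite: Garlik2019, §7 (proof of Thm 26)] -/
theorem good_A17 (ht : 0 < t) {C : Clause RefVar}
    (hC : C ∈ RefCNF.A17 false (q + t * (X.length + 1)) X.length) : Good X F q t C := by
  simp only [RefCNF.A17, pfx_false, List.nil_append, List.mem_flatMap, List.mem_map,
    List.mem_range, List.mem_filter] at hC
  obtain ⟨u, hu, v, -, ℓ, hℓ, ℓ', ⟨hℓ', hne⟩, b, hb, rfl⟩ := hC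
  have hne' : ℓ' ≠ ℓ := by simpa using hne
  rcases line_cases q t u with hpre | ⟨-, h0⟩ | ⟨hq, h0⟩
  · exact good_of_sat (.V u (some ℓ), false) (by simp) (rho_V_some_of_lt hpre ℓ)
  · exact good_of_sat (.V u (some ℓ), false) (by simp) (rho_V_some_of_lvl_zero h0 ℓ)
  · by_cases hv : q ≤ v ∧ lvl q t v + 1 = lvl q t u
    · refine good_of_map
        [(LRefVar.R (lvl q t u) (pos q t u) (pos q t v), false),
          (LRefVar.V (lvl q t u) (pos q t u) ℓ, false),
          (LRefVar.D (lvl q t v) (pos q t v) ℓ' b, false),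
          (LRefVar.D (lvl q t u) (pos q t u) ℓ' b, true)]
        (mem_lref ?_) ?_ (by simp [ren])
      · refine Or.inr (Or.inr (Or.inr (Or.inr (Or.inr (Or.inl ?_)))))
        simp only [LevelledRefCNF.B6, List.mem_flatMap, List.mem_map, List.mem_range,
          List.mem_filter]
        refine ⟨lvl q t v, lvl_mem_lowerLevels_of_good ht hu hv, pos q t u, pos_lt ht u, pos q t v,
          pos_lt ht v, ℓ, hℓ, ℓ', hℓ', b, ⟨?_, by simp [hne']⟩, ?_⟩
        · cases b <;> simp
        · rw [hv.2]
      · intro l hl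
        simp only [List.mem_cons, List.not_mem_nil, or_false] at hl
        rcases hl with rfl | rfl | rfl | rfl
        · exact rho_L_some_of_good hq h0 hv.1 hv.2
        · exact rho_V_some_of_upper hq h0 ℓ
        · exact rho_D_of_le hv.1 ℓ' b
        · exact rho_D_of_le hq ℓ' b
    · exact good_of_sat (.L u (some v), false) (by simp) (rho_L_some_of_bad hq h0 hv)

/-- Family (A18): as (A17), giving a clause of (B5).
[cite: Garlik2019, §7 (proof of Thm 26)] -/
theorem good_A18 (ht : 0 < t) {C : Clause RefVar}
    (hC : C ∈ RefCNF.A18 false (q + t * (X.length + 1)) X.length) : Good X F q t C := by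
  simp only [RefCNF.A18, pfx_false, List.nil_append, List.mem_flatMap, List.mem_map,
    List.mem_range, List.mem_filter] at hC
  obtain ⟨u, hu, v, -, ℓ, hℓ, ℓ', ⟨hℓ', hne⟩, b, hb, rfl⟩ := hC
  have hne' : ℓ' ≠ ℓ := by simpa using hne
  rcases line_cases q t u with hpre | ⟨-, h0⟩ | ⟨hq, h0⟩
  · exact good_of_sat (.V u (some ℓ), false) (by simp) (rho_V_some_of_lt hpre ℓ)
  · exact good_of_sat (.V u (some ℓ), false) (by simp) (rho_V_some_of_lvl_zero h0 ℓ)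
  · by_cases hv : q ≤ v ∧ lvl q t v + 1 = lvl q t u
    · refine good_of_map
        [(LRefVar.L (lvl q t u) (pos q t u) (pos q t v), false),
          (LRefVar.V (lvl q t u) (pos q t u) ℓ, false),
          (LRefVar.D (lvl q t v) (pos q t v) ℓ' b, false),
          (LRefVar.D (lvl q t u) (pos q t u) ℓ' b, true)]
        (mem_lref ?_) ?_ (by simp [ren])
      · refine Or.inr (Or.inr (Or.inr (Or.inr (Or.inl ?_))))
        simp only [LevelledRefCNF.B5, List.mem_flatMap, List.mem_map, List.mem_range,
          List.mem_filter]
        refine ⟨lvl q t v, lvl_mem_lowerLevels_of_good ht hu hv, pos q t u, pos_lt ht u, pos q t v,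
          pos_lt ht v, ℓ, hℓ, ℓ', hℓ', b, ⟨?_, by simp [hne']⟩, ?_⟩
        · cases b <;> simp
        · rw [hv.2]
      · intro l hl
        simp only [List.mem_cons, List.not_mem_nil, or_false] at hl
        rcases hl with rfl | rfl | rfl | rfl
        · exact rho_R_some_of_good hq h0 hv.1 hv.2
        · exact rho_V_some_of_upper hq h0 ℓ
        · exact rho_D_of_le hv.1 ℓ' b
        · exact rho_D_of_le hq ℓ' b
    · exact good_of_sat (.R u (some v), false) (by simp) (rho_R_some_of_bad hq h0 hv)

/-- Family (A19): on the prefix it is satisfied (`I(u) = 1` and `D_u ⊇ C_1`), on higher levels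
too (`I(u) = 0`), and on the first level it is the clause (B1).
[cite: Garlik2019, §7 (proof of Thm 26)] -/
theorem good_A19 (ht : 0 < t) {C : Clause RefVar}
    (hC : C ∈ RefCNF.A19 false X F (q + t * (X.length + 1))) : Good X F q t C := by
  simp only [RefCNF.A19, pfx_false, List.nil_append, List.mem_flatMap, List.mem_map,
    List.mem_range] at hC
  obtain ⟨u, -, m, hm, x, hx, rfl⟩ := hC
  rcases line_cases q t u with hpre | ⟨hq, h0⟩ | ⟨hq, h0⟩
  · by_cases hm0 : m = 0
    · subst hm0
      refine good_of_sat (.D u (X.idxOf x.1) x.2, true) (by simp) ?_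
      rw [rho_D_of_lt hpre]
      simp only [Option.some.injEq, List.any_eq_true, Bool.and_eq_true, beq_iff_eq]
      exact ⟨x, hx, rfl, rfl⟩
    · refine good_of_sat (.I u (some m), false) (by simp) ?_
      rw [rho_I_some_of_lt hpre]
      simp [hm0]
  · refine good_of_map
      [(LRefVar.I (pos q t u) m, false), (LRefVar.D 0 (pos q t u) (X.idxOf x.1) x.2, true)]
      (mem_lref ?_) ?_ (by simp [ren, h0])
    · refine Or.inl ?_
      simp only [LevelledRefCNF.B1, List.mem_flatMap, List.mem_map, List.mem_range]
      exact ⟨pos q t u, pos_lt ht u, m, hm, x, hx, rfl⟩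
    · intro l hl
      simp only [List.mem_cons, List.not_mem_nil, or_false] at hl
      rcases hl with rfl | rfl
      · exact rho_I_some_of_lvl_zero hq h0 m
      · exact rho_D_of_le hq _ _
  · exact good_of_sat (.I u (some m), false) (by simp) (rho_I_some_of_upper hq h0 m)

/-- Variables of `F` are listed in `X` (hypothesis of the prefix case of (A20)). On the prefix the
two `D`-values of a variable are not both true because `C_1 = F[0]` is not tautological.
[folklore] -/
theorem not_both_any {ℓ : ℕ} (hF : 0 < F.length) (hX : ∀ C ∈ F, ∀ l ∈ C, l.1 ∈ X)
    (hnt : ∀ C ∈ F.clauseFinsets, IsNonTaut C)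
    (h0 : ((F.getD 0 []).any fun l => X.idxOf l.1 == ℓ && l.2 == false) = true) :
    ((F.getD 0 []).any fun l => X.idxOf l.1 == ℓ && l.2 == true) = false := by
  rw [List.getD_eq_getElem _ _ hF] at h0 ⊢
  have hmem : F[0] ∈ F := List.getElem_mem hF
  rw [Bool.eq_false_iff]
  intro h1
  simp only [List.any_eq_true, Bool.and_eq_true, beq_iff_eq] at h0 h1
  obtain ⟨⟨y, b⟩, hy, hyℓ, hb⟩ := h0
  obtain ⟨⟨y', b'⟩, hy', hyℓ', hb'⟩ := h1
  simp only at hyℓ hb hyℓ' hb'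
  subst hb hb'
  have hyy : y' = y := by
    have := (List.idxOf_inj (hX _ hmem _ hy')).1 (hyℓ'.trans hyℓ.symm)
    exact this
  subst hyy
  exact hnt (F[0]).toFinset (List.mem_map.2 ⟨F[0], hmem, rfl⟩) y'
    ⟨List.mem_toFinset.2 hy', List.mem_toFinset.2 hy⟩

/-- Family (A20): on the prefix it is satisfied because `C_1` is not tautological; on level lines
it is the clause (B2). [cite: Garlik2019, §7 (proof of Thm 26)] -/
theorem good_A20 (ht : 0 < t) (hF : 0 < F.length) (hX : ∀ C ∈ F, ∀ l ∈ C, l.1 ∈ X)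
    (hnt : ∀ C ∈ F.clauseFinsets, IsNonTaut C) {C : Clause RefVar}
    (hC : C ∈ RefCNF.A20 false (q + t * (X.length + 1)) X.length) : Good X F q t C := by
  simp only [RefCNF.A20, pfx_false, List.nil_append, List.mem_flatMap, List.mem_map,
    List.mem_range] at hC
  obtain ⟨u, hu, ℓ, hℓ, rfl⟩ := hC
  by_cases hpre : u < q
  · by_cases h0 : ((F.getD 0 []).any fun l => X.idxOf l.1 == ℓ && l.2 == false) = true
    · refine good_of_sat (.D u ℓ true, false) (by simp) ?_
      rw [rho_D_of_lt hpre, not_both_any X F hF hX hnt h0]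
    · refine good_of_sat (.D u ℓ false, false) (by simp) ?_
      rw [rho_D_of_lt hpre]
      simpa using h0
  · have hq : q ≤ u := not_lt.1 hpre
    refine good_of_map
      [(LRefVar.D (lvl q t u) (pos q t u) ℓ true, false),
        (LRefVar.D (lvl q t u) (pos q t u) ℓ false, false)]
      (mem_lref ?_) ?_ ?_
    · refine Or.inr (Or.inl ?_)
      simp only [LevelledRefCNF.B2, List.mem_flatMap, List.mem_map, List.mem_range]
      exact ⟨lvl q t u, Nat.lt_succ_of_le (lvl_le ht hu), pos q t u, pos_lt ht u, ℓ, hℓ, rfl⟩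
    · intro l hl
      simp only [List.mem_cons, List.not_mem_nil, or_false] at hl
      rcases hl with rfl | rfl
      · exact rho_D_of_le hq ℓ false
      · exact rho_D_of_le hq ℓ true
    · simp only [List.map_cons, List.map_nil, ren, List.toFinset_cons, List.toFinset_nil]
      rw [Finset.insert_comm]

/-- Family (A21): the last line is the clause `C_{n+1,t}` (level `n`, position `t-1`), giving the
clause (B7). [cite: Garlik2019, §7 (proof of Thm 26)] -/
theorem good_A21 (ht : 0 < t) {C : Clause RefVar}
    (hC : C ∈ RefCNF.A21 false (q + t * (X.length + 1)) X.length) : Good X F q t C := by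
  simp only [RefCNF.A21, pfx_false, List.nil_append, List.mem_flatMap, List.mem_map,
    List.mem_range, List.mem_filter, decide_eq_true_eq] at hC
  obtain ⟨u, ⟨-, hu⟩, ℓ, hℓ, b, hb, rfl⟩ := hC
  have hu' : u = q + t * X.length + (t - 1) := by rw [Nat.mul_succ] at hu; omega
  obtain ⟨hl, hp⟩ := lvl_pos_mk (q := q) ht X.length (j := t - 1) (by omega)
  rw [← hu'] at hl hp
  have hq : q ≤ u := by omega
  refine good_of_map [(LRefVar.D X.length (t - 1) ℓ b, false)] (mem_lref ?_) ?_
    (by simp [ren, hl, hp])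
  · refine Or.inr (Or.inr (Or.inr (Or.inr (Or.inr (Or.inr (Or.inl ?_))))))
    simp only [LevelledRefCNF.B7, List.mem_flatMap, List.mem_map, List.mem_range, List.mem_filter,
      decide_eq_true_eq]
    exact ⟨X.length, ⟨Nat.lt_succ_self _, rfl⟩, t - 1, ⟨by omega, by omega⟩, ℓ, hℓ, b, hb, rfl⟩
  · intro l hl
    simp only [List.mem_cons, List.not_mem_nil, or_false] at hl
    subst hl
    exact rho_D_of_le hq ℓ b

/-- **Every clause of `REF(F, q + t(n+1))` is good**: satisfied by Garlík's partial assignment, or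
restricted-and-renamed into a clause of `REF^F_{n+1,t}` (`n = |X|`; hypotheses: `t ≥ 1`, `F`
non-empty with non-tautological clauses over the variables `X`).
[cite: Garlik2019, §7 (proof of Thm 26)] -/
theorem good_of_mem_ref (ht : 0 < t) (hF : 0 < F.length) (hX : ∀ C ∈ F, ∀ l ∈ C, l.1 ∈ X)
    (hnt : ∀ C ∈ F.clauseFinsets, IsNonTaut C) {C : Clause RefVar}
    (hC : C ∈ RefCNF.ref X F (q + t * (X.length + 1))) : Good X F q t C := by
  simp only [RefCNF.ref, RefCNF.blocks, List.mem_append] at hC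
  rcases hC with ((((((((((((((((((((h | h) | h) | h) | h) | h) | h) | h) | h) | h) | h) | h) |
    h) | h) | h) | h) | h) | h) | h) | h) | h)
  · exact good_A1 X F ht h
  · exact good_A2 X F ht hF h
  · exact good_A3 X F ht h
  · exact good_A4 X F ht h
  · exact good_A5 X F ht h
  · exact good_A6 X F ht h
  · exact good_A7 X F ht h
  · exact good_A8 X F ht h
  · exact good_A9 X F h
  · exact good_A10 X F h
  · exact good_A11 X F h
  · exact good_A12 X F h
  · exact good_A13 X F h
  · exact good_A14 X F h
  · exact good_A15 X F ht h
  · exact good_A16 X F ht h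
  · exact good_A17 X F ht h
  · exact good_A18 X F ht h
  · exact good_A19 X F ht h
  · exact good_A20 X F ht hF hX hnt h
  · exact good_A21 X F ht h

end Families

/-! ### The three transfers: `ℕ`-coding → `RefVar` → `LRefVar` → `ℕ`-coding -/

section Transfers

/-- `REF(F,s)` has a clause when `s ≥ 1` (e.g. the clause (A1) of line `0`). [folklore] -/
theorem ref_ne_nil (X : List ℕ) (F : CNF ℕ) {s : ℕ} (hs : 0 < s) : RefCNF.ref X F s ≠ [] := by
  intro h
  have hmem : (RefCNF.pfx false 0 ++ (RefCNF.optRange X.length).map fun i => (RefVar.V 0 i, true)) ∈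
      RefCNF.ref X F s := by
    simp only [RefCNF.ref, RefCNF.blocks, List.mem_append]
    repeat apply Or.inl
    exact List.mem_map.2 ⟨0, List.mem_range.2 hs, rfl⟩
  rw [h] at hmem
  simp at hmem

/-- `REF^F_{s,t}` has a clause when `t ≥ 1` (e.g. the clause (B9) of position `0`). [folklore] -/
theorem lref_ne_nil (X : List ℕ) (F : CNF ℕ) (s : ℕ) {t : ℕ} (ht : 0 < t) :
    LevelledRefCNF.lref X F s t ≠ [] := by
  intro h
  have hmem : ((List.range F.length).map fun m => (LRefVar.I 0 m, true)) ∈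
      LevelledRefCNF.lref X F s t := by
    refine mem_lref
      (Or.inr (Or.inr (Or.inr (Or.inr (Or.inr (Or.inr (Or.inr (Or.inr (Or.inl ?_)))))))))
    exact List.mem_map.2 ⟨0, List.mem_range.2 ht, rfl⟩
  rw [h] at hmem
  simp at hmem

/-- **Step A** (decoding): a refutation of `refCNF F s` over `ℕ` gives a refutation of the
structured `REF(F,s)` over `RefVar` of the same length (rename along `RefVar.decode`, killing the
naturals that are not codes). [folklore] -/
theorem exists_refutation_ref_of_refCNF (F : CNF ℕ) {s : ℕ} (hs : 0 < s) {π : List (ResLine ℕ)}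
    (hπ : IsResRefutation (refCNF F s) π) :
    ∃ π' : List (ResLine RefVar),
      IsResRefutation (RefCNF.ref (RefCNF.sortedVars F) F s) π' ∧ π'.length = π.length := by
  classical
  refine hπ.exists_map_restrict
    (fun k => if (RefVar.decode k).code = k then none else some false) RefVar.decode ?_
    (ref_ne_nil _ F hs) ?_
  · intro x y hx hy hxy
    have hx' : (RefVar.decode x).code = x := by
      by_contra h
      rw [if_neg h] at hx
      exact absurd hx (by simp)
    have hy' : (RefVar.decode y).code = y := by
      by_contra h
      rw [if_neg h] at hy
      exact absurd hy (by simp)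
    rw [← hx', ← hy', hxy]
  · intro C hC
    simp only [refCNF, RefCNF.toNat, CNF.clauseFinsets, List.map_map, List.mem_map,
      Function.comp_apply] at hC
    obtain ⟨A, hA, rfl⟩ := hC
    right
    have : (restrictClause (fun k => if (RefVar.decode k).code = k then none else some false)
        (List.map (fun l : Literal RefVar => ((l.1.code, l.2) : Literal ℕ)) A).toFinset).image
          (fun l => ((RefVar.decode l.1, l.2) : Literal RefVar)) = A.toFinset := by
      ext l
      simp only [Finset.mem_image, mem_restrictClause, List.mem_toFinset, List.mem_map]
      constructor
      · rintro ⟨l', ⟨⟨a, ha, rfl⟩, -⟩, rfl⟩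
        simpa using ha
      · intro hl
        exact ⟨(l.1.code, l.2), ⟨⟨l, hl, rfl⟩, by simp⟩, by simp⟩
    rw [this]
    exact List.mem_map.2 ⟨A, hA, rfl⟩

/-- **Step B** (Garlík's substitution): a refutation of `REF(F, q + t(n+1))` over `RefVar` gives
a refutation of `REF^F_{n+1,t}` over `LRefVar` of the same length (`n = |X|`, `X` listing the
variables of `F`). [cite: Garlik2019, §7 (proof of Thm 26)] -/
theorem exists_refutation_lref_of_ref {X : List ℕ} {F : CNF ℕ} {q t : ℕ} (ht : 0 < t)
    (hF : 0 < F.length) (hX : ∀ C ∈ F, ∀ l ∈ C, l.1 ∈ X)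
    (hnt : ∀ C ∈ F.clauseFinsets, IsNonTaut C) {π : List (ResLine RefVar)}
    (hπ : IsResRefutation (RefCNF.ref X F (q + t * (X.length + 1))) π) :
    ∃ π' : List (ResLine LRefVar),
      IsResRefutation (LevelledRefCNF.lref X F (X.length + 1) t) π' ∧ π'.length = π.length := by
  refine hπ.exists_map_restrict (rho X F q t) (ren q t) (ren_injOn ht) (lref_ne_nil X F _ ht) ?_
  intro C hC
  obtain ⟨A, hA, rfl⟩ := List.mem_map.1 hC
  exact good_of_mem_ref X F ht hF hX hnt hA

/-- **Step C** (coding): a refutation of the structured `REF^F_{s,t}` over `LRefVar` gives a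
refutation of `levelledRefCNF`-style coded formula over `ℕ` of the same length (rename along the
injective `LRefVar.code`). [folklore] -/
theorem exists_refutation_toNat_of_lref {X : List ℕ} {F : CNF ℕ} {s t : ℕ} (ht : 0 < t)
    {π : List (ResLine LRefVar)} (hπ : IsResRefutation (LevelledRefCNF.lref X F s t) π) :
    ∃ π' : List (ResLine ℕ),
      IsResRefutation (LevelledRefCNF.toNat (LevelledRefCNF.lref X F s t)) π' ∧
        π'.length = π.length := by
  refine hπ.exists_map_rename LRefVar.code LRefVar.code_injective ?_ ?_
  · intro h
    exact lref_ne_nil X F s ht (List.map_eq_nil_iff.1 h)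
  · intro C hC
    obtain ⟨B, hB, rfl⟩ := List.mem_map.1 hC
    have : B.toFinset.image (fun l => ((l.1.code, l.2) : Literal ℕ)) =
        (B.map fun l => ((l.1.code, l.2) : Literal ℕ)).toFinset := by
      ext l
      simp [List.mem_toFinset, Finset.mem_image, List.mem_map]
    rw [this]
    exact List.mem_map.2 ⟨_, List.mem_map.2 ⟨B, hB, rfl⟩, rfl⟩

end Transfers

end GarlikTransfer

/-! ### Theorem 26 from Theorem 1 -/

/-- Occurring variables of `F` are listed by `sortedVars`. [folklore] -/
theorem RefCNF.fst_mem_sortedVars {F : CNF ℕ} {C : Clause ℕ} (hC : C ∈ F) {l : Literal ℕ}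
    (hl : l ∈ C) : l.1 ∈ RefCNF.sortedVars F := by
  rw [RefCNF.mem_sortedVars]
  simp only [CNF.vars, List.mem_toFinset, List.mem_map, List.mem_flatten]
  exact ⟨l, ⟨C, hC, hl⟩, rfl⟩

/-- **Garlík's substitution, length form** [Garlík 2019, §7]: for `t = ⌊s̃/(n+1)⌋ ≥ 1`
(`n = |vars F|`, `F` non-empty with non-tautological clauses), every Resolution refutation of
`REF(F,s̃) = refCNF F s̃` yields a Resolution refutation of
`REF^F_{n+1,t} = levelledRefCNF F (n+1) t`
of the same length. [cite: Garlik2019, §7 (proof of Thm 26: "the substitution just described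
takes any refutation of REF(F,s̃) to a refutation of REF^F_{n+1,t} without any increase in
size")] -/
theorem exists_levelled_refutation_of_refCNF (F : CNF ℕ) (s : ℕ)
    (ht : 0 < s / ((CNF.vars F).card + 1)) (hF : 0 < F.length)
    (hnt : ∀ C ∈ F.clauseFinsets, IsNonTaut C) {π : List (ResLine ℕ)}
    (hπ : IsResRefutation (refCNF F s) π) :
    ∃ π' : List (ResLine ℕ),
      IsResRefutation (levelledRefCNF F ((CNF.vars F).card + 1) (s / ((CNF.vars F).card + 1))) π' ∧
        π'.length = π.length := by
  have hXn : (RefCNF.sortedVars F).length = (CNF.vars F).card := RefCNF.length_sortedVars F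
  have hs : s = s % ((CNF.vars F).card + 1) +
      s / ((CNF.vars F).card + 1) * ((RefCNF.sortedVars F).length + 1) := by
    rw [hXn]
    have := Nat.div_add_mod s ((CNF.vars F).card + 1)
    rw [Nat.mul_comm] at this
    omega
  have hspos : 0 < s := by
    have : 0 < s / ((CNF.vars F).card + 1) * ((CNF.vars F).card + 1) :=
      Nat.mul_pos ht (Nat.succ_pos _)
    have := Nat.div_mul_le_self s ((CNF.vars F).card + 1)
    omega
  -- Step A
  obtain ⟨πA, hπA, hlenA⟩ := GarlikTransfer.exists_refutation_ref_of_refCNF F hspos hπ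
  rw [hs] at hπA
  -- Step B
  obtain ⟨πB, hπB, hlenB⟩ := GarlikTransfer.exists_refutation_lref_of_ref ht hF
    (fun C hC l hl => RefCNF.fst_mem_sortedVars hC hl) hnt hπA
  have key : LevelledRefCNF.lref (RefCNF.sortedVars F) F ((RefCNF.sortedVars F).length + 1)
      (s / ((CNF.vars F).card + 1)) =
      LevelledRefCNF.lref ((CNF.vars F).sort (· ≤ ·)) F ((CNF.vars F).card + 1)
        (s / ((CNF.vars F).card + 1)) := by
    rw [hXn]
    rfl
  rw [key] at hπB
  -- Step C
  obtain ⟨πC, hπC, hlenC⟩ := GarlikTransfer.exists_refutation_toNat_of_lref ht hπB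
  refine ⟨πC, ?_, by rw [hlenC, hlenB, hlenA]⟩
  rw [levelledRefCNF_eq]
  exact hπC

/-- **[Garlík 2019, Thm 26] from [Garlík 2019, Thm 1]**: Garlík's Resolution length lower bound
for the Atserias–Müller refutation statement `REF(F,s̃)` (the named fact
`refCNF_lowerBound_Garlik`) follows from his lower bound for the levelled refutation statement
`REF^F_{s,t}` (the named fact `levelledRefCNF_lowerBound`), with the same `δ` and `t₀`, by the
substitution of §7: apply Theorem 1 with `s = n + 1` levels and `t = ⌊s̃/(n+1)⌋` (note
`t ≥ r^{3+ε} ≥ n³ ≥ n + 1`) to the refutation of `REF^F_{n+1,t}` obtained from a refutation of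
`REF(F,s̃)` without increase in length.
[cite: Garlik2019, Thm 26 (arXiv:1905.12372 §7), proof from Thm 1] -/
theorem refCNF_lowerBound_Garlik_of_levelled (h : levelledRefCNF_lowerBound) :
    refCNF_lowerBound_Garlik := by
  intro ε hε
  obtain ⟨δ, hδ, t₀, H⟩ := h ε hε
  refine ⟨δ, hδ, t₀, ?_⟩
  intro F s hn2 hnr hpow ht0 hnt hunsat π hπ
  set n := (CNF.vars F).card with hn
  set t := s / (n + 1) with htdef
  -- `n + 1 ≤ t` from `t ≥ r^{3+ε} ≥ r³ ≥ n³`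
  have hr1 : (1 : ℝ) ≤ (F.length : ℝ) := by
    have : 1 ≤ F.length := le_trans (by norm_num) (hn2.trans hnr)
    exact_mod_cast this
  have hpow3 : (F.length : ℝ) ^ (3 : ℝ) ≤ (F.length : ℝ) ^ (3 + ε) :=
    Real.rpow_le_rpow_of_exponent_le hr1 (by linarith)
  have hcube : (F.length : ℝ) ^ (3 : ℝ) = ((F.length ^ 3 : ℕ) : ℝ) := by
    rw [show (3 : ℝ) = ((3 : ℕ) : ℝ) by norm_num, Real.rpow_natCast]
    push_cast
    ring
  have hnt1 : n + 1 ≤ t := by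
    have h1 : n + 1 ≤ F.length ^ 3 :=
      calc n + 1 ≤ 2 * n := by omega
        _ ≤ n * n := Nat.mul_le_mul_right n hn2
        _ ≤ n * n * n := Nat.le_mul_of_pos_right _ (by omega)
        _ = n ^ 3 := by ring
        _ ≤ F.length ^ 3 := Nat.pow_le_pow_left hnr 3
    have h2 : ((F.length ^ 3 : ℕ) : ℝ) ≤ (t : ℝ) := by
      rw [← hcube]
      exact hpow3.trans hpow
    have h3 : ((n + 1 : ℕ) : ℝ) ≤ (t : ℝ) := le_trans (by exact_mod_cast h1) h2
    exact_mod_cast h3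
  have htpos : 0 < t := by omega
  have hF : 0 < F.length := by omega
  obtain ⟨π', hπ', hlen⟩ := exists_levelled_refutation_of_refCNF F s htpos hF hnt hπ
  have := H F (n + 1) t hnt1 le_rfl hn2 hnr hpow ht0 hnt hunsat π' hπ'
  rw [hlen] at this
  exact this

/-- **Garlík's lower bound for `REF(F,s̃)`, discharged** [Garlík 2019, Thm 26]: the named fact
`refCNF_lowerBound_Garlik` holds — for every `ε > 0` there are `δ > 0` and `t₀` such that for
`r ≥ n ≥ 2`, `t := ⌊s̃/(n+1)⌋ ≥ r^{3+ε}`, `t ≥ t₀` and `F` an unsatisfiable CNF of `r`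
non-tautological clauses in `n` variables, every Resolution refutation of `REF(F,s̃)` has length
`> 2^{t^δ}` — by `refCNF_lowerBound_Garlik_of_levelled` (Thm 26 from Thm 1, the substitution of
[Garlík 2019, §7], this file) applied to the discharge `levelledRefCNF_lowerBound_holds` of
[Garlík 2019, Thm 1] (`LevelledRefutationCNFProofs.lean`).
[cite: Garlik2019, Thm 26 (arXiv:1905.12372 §7, p. 20), from Thm 1] -/
theorem refCNF_lowerBound_Garlik_holds : refCNF_lowerBound_Garlik :=
  refCNF_lowerBound_Garlik_of_levelled levelledRefCNF_lowerBound_holds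

end Literature.Computability.MetaComplexity
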